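import Summits.Ventures.HodgeRepro2.T7SupportRegularOnePlace

/-!
# A non-vacuity witness for the displayed hypotheses of rows 721–723 (support, seat p1)

README §10.5 (ii)(c)/(d) asks, for a displayed hypothesis set, that «no hypothesis quantifies over an empty /
uninstantiable carrier» and that «the hypotheses instantiate simultaneously on at least one toy / model instance».
This file is that instance for the level-place regularity chain of p1's rows 721 (`T7SupportRegularStabilizer`),
722 (`T7SupportRegularTransport`) and 723 (`T7SupportRegularOnePlace`) — explicit data on which EVERY displayed
hypothesis of `regular_of_kappa`, `hmatch_of_central` and `regular_GL_map_of_map_kappa` is discharged in the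
kernel, none by `trivial` / `simp` on a definitionally true statement (each is an identity on explicit numbers), and
with nothing degenerate where a choice exists:

* the field `ℂ` with the involution `σ = starRingEnd ℂ` (complex conjugation: `σ ≠ id` (`σW_ne_id`), `σ ∘ σ = id`);
* the DEFINITE orthogonal data `d = (1, 1)` (the compact place `U(2)` of row 694, `dd2`), the second basis `f` = the
  standard basis (so `P = 1`, `disc' σ d f 0 = 1`);
* TWO isometries: (W) `γW = [[3/5, −4/5], [4/5, 3/5]]`, the rotation by the rational point `(3/5, 4/5)` of the unit
  circle — a REAL orthogonal matrix (entries fixed by `σ`), a real point of `U(2)`; and (U) `γU = [[3i/5, −4/5],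
  [4/5, −3i/5]] ∈ SU(2)`, a genuinely unitary, NON-orthogonal isometry whose entries are MOVED by `σ`
  (`rotU_moved : σ (γU)₀₀ ≠ (γU)₀₀`); both are units of `Matrix (Fin 2) (Fin 2) ℂ` with explicit inverses, and
  `IsIsom σ d γ` is the polynomial identity `(3x₀ − 4x₁)(3ȳ₀ − 4ȳ₁) + (4x₀ + 3x₁)(4ȳ₀ + 3ȳ₁) = 25 (x₀ȳ₀ + x₁ȳ₁)`
  for (W), and `(3i x₀ − 4x₁)(−3i ȳ₀ − 4ȳ₁) + (4x₀ − 3i x₁)(4ȳ₀ + 3i ȳ₁) = 25 (x₀ȳ₀ + x₁ȳ₁)` (using `i² = −1`) for (U);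
* the double-coset invariant of row 662 evaluated on the data — `kappa σ d f γ = N(c₀₀) / (d₀ · d′₀)` with
  `c₀₀ = d₀ · (γ f₀)₀ = (γ)₀₀` (the `(0,0)` entry, since `f₀ = e₀` and `d₀ = 1`), `N(c) = c · σ(c) = |c|²`, and
  `d′₀ = h(f₀, f₀) = 1`: so `κ(γW) = |3/5|² / 1 = 9/25` and `κ(γU) = |3i/5|² / 1 = 9/25`, both `∉ {0, 1}`
  (`kappa_W`, `kappa_U`); hence `Regular 1 γ` by row 721's `regular_of_kappa` (`regular_W`, `regular_U`) —
  cross-checked against the definition (`regular_W_direct`: the column `(3/5, 4/5)` of `γW · 1` has no zero entry;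
  the two agreeing is the check);
* the characters `χA = det ∘ iotaA : torusA σ →* ℂˣ` and `ψB = (det ∘ iotaB)⁻¹ : torusB σ f →* ℂˣ` — BOTH
  non-trivial: at the norm-one diagonal element `diag(−1, 1)` of either torus they take the value `−1`
  (`χA_W_ne_one`, `ψB_W_ne_one`) — whose product is `1` on the norm-one scalars `(scalarA σ z, scalarB σ f z)`:
  `det (iotaA (scalarA z)) = z²` and `det (iotaB (scalarB z)) = z²` (`det_iotaA_scalarA`, `det_iotaB_scalarB`, from
  row 721's `coe_iotaA_scalarA` / `coe_iotaB_scalarB` and `Matrix.det_smul`), so `z² · (z²)⁻¹ = 1` (`hC_W`); row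
  721's consumer `hmatch_of_central` then yields x1's `hmatch` binder for each datum (`hmatch_W`, `hmatch_U`);
* two embeddings for row 723: `ψ₁ = ψ₂ = σ` (conjugation at both — `κ = 9/25` is real, so `ψ₁(κ) ∉ {0, 1}`), giving
  `Regular (map σ 1) (map σ γ)` from `regular_GL_map_of_map_kappa` (`regular_map_W`, `regular_map_U`), and
  `ψ₁ = σ`, `ψ₂ = id` (`regular_map_W'`).

WHAT THIS SHOWS: the displayed hypothesis set of rows 721–723 (orthogonal `σ`-fixed non-zero data, a second basis
with non-zero discriminant, an isometry with `κ ∉ {0, 1}` read at an embedding, the two matrix equations at the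
other embedding, the central-character condition (C) on the norm-one scalars) is JOINTLY SATISFIABLE in the kernel,
as statements over a field with an involution, with a non-trivial involution, non-trivial isometries (one of them
not orthogonal) and non-trivial characters — so no hypothesis of the three rows is vacuous or definitionally true.
WHAT IT DOES NOT SHOW: the witness data are of ARCHIMEDEAN type — the DEFINITE form (`d = (1, 1)`, signature
`(2, 0)`) of row 694's `U(2)` over `ℂ/ℝ` with its continuous conjugation — NOT a non-archimedean completion, NOT the
`(1, 1)`-signature of the seesaw at `ι₂ / ι₃`, and NOT a CM number field over a totally real subfield (no number
field, no places, no ring of integers occurs): the file says nothing about the satisfiability of the set over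
`F = E_{v₁}` with the local second basis and the completion's `σ`, nor about the REAL datum of the line (`loc γ₀`,
`μ_{A,v₁}`, `μ_{B,v₁}⁻¹`), nor about any number-field instance — the witness is a member of the class the rows
quantify over, not the member the dictionary names (that remains the `[W]` sentence of record, crit-1 l. 15949 (d));
it is not cited for (a′), (b′), (N), (P), the real `X`, or HC_CM. [M]-level, referee-facing (the census cites it
under (h⁗⁵) as the non-vacuity witness of rows 721–723); the `[W]` column is unchanged; LEMMAS CLOSING THE STEP 0;
§8(d): NO.
Blind lane: Mathlib + the HodgeRepro2 prefix; no sorry; axioms ⊆ {propext, Classical.choice, Quot.sound}.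
-/

namespace Summit.Ventures.HodgeRepro2.T7SupportRegularWitness

open Matrix Complex Summit.Ventures.HodgeRepro2.T7SupportTwoTorusInvariant
  Summit.Ventures.HodgeRepro2.Tier7.Line3.TorusSupport
  Summit.Ventures.HodgeRepro2.T7SupportRegularStabilizer
  Summit.Ventures.HodgeRepro2.T7SupportRegularTransport
  Summit.Ventures.HodgeRepro2.T7SupportRegularOnePlace

/-! ## The common datum: the involution, the definite form, the standard second basis -/

/-- the involution of the witness: complex conjugation. -/
abbrev σW : ℂ →+* ℂ := starRingEnd ℂ

/-- the involution is not the identity (`σ i = −i`). -/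
theorem σW_ne_id : σW ≠ RingHom.id ℂ := by
  intro h
  have := congrArg (fun φ : ℂ →+* ℂ => φ Complex.I) h
  simp [σW, Complex.conj_I] at this
  exact Complex.I_ne_zero (by linear_combination (-1 / 2 : ℂ) * this)

/-- the definite orthogonal data `d = (1, 1)`. -/
def dW : Fin 2 → ℂ := fun _ => 1

/-- the second basis: the standard basis `f j = e_j`. -/
def fW : Fin 2 → Fin 2 → ℂ := fun j => Pi.single j 1

/-- `d` is `σ`-fixed. -/
theorem hd_W : ∀ i, σW (dW i) = dW i := fun _ => by simp [dW, σW]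

/-- `d` has no zero entry. -/
theorem hd0_W : ∀ i, dW i ≠ 0 := fun _ => one_ne_zero

/-- the discriminant of the second basis at `j = 0` is `1`. -/
theorem disc'_W : disc' σW dW fW 0 = 1 := by
  simp [disc', herm, dW, fW, Fin.sum_univ_two, σW]

/-- … hence non-zero. -/
theorem hf0_W : disc' σW dW fW 0 ≠ 0 := by rw [disc'_W]; exact one_ne_zero

/-- the columns of `P = 1` are the second basis. -/
theorem hP_W : ∀ j, ((1 : GL (Fin 2) ℂ) : Matrix (Fin 2) (Fin 2) ℂ).col j = fW j := by
  intro j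
  ext i
  simp [fW, Matrix.col, Matrix.one_apply, Pi.single_apply, eq_comm]

/-! ## Witness (W): the real rotation `(3/5, 4/5)` -/

/-- the rotation by the rational point `(3/5, 4/5)` of the unit circle. -/
noncomputable def rotW : Matrix (Fin 2) (Fin 2) ℂ := !![3 / 5, -4 / 5; 4 / 5, 3 / 5]

/-- its inverse, the rotation by `(3/5, −4/5)`. -/
noncomputable def rotWinv : Matrix (Fin 2) (Fin 2) ℂ := !![3 / 5, 4 / 5; -4 / 5, 3 / 5]

/-- `rotW · rotWinv = 1`. -/
theorem rotW_mul_rotWinv : rotW * rotWinv = 1 := by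
  ext i j
  fin_cases i <;> fin_cases j <;>
    simp [rotW, rotWinv, Matrix.mul_apply, Fin.sum_univ_two] <;> norm_num

/-- `rotWinv · rotW = 1`. -/
theorem rotWinv_mul_rotW : rotWinv * rotW = 1 := by
  ext i j
  fin_cases i <;> fin_cases j <;>
    simp [rotW, rotWinv, Matrix.mul_apply, Fin.sum_univ_two] <;> norm_num

/-- the rotation as an element of `GL (Fin 2) ℂ`. -/
noncomputable def γW : GL (Fin 2) ℂ := ⟨rotW, rotWinv, rotW_mul_rotWinv, rotWinv_mul_rotW⟩

/-- the matrix of `γW`. -/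
theorem coe_γW : (γW : Matrix (Fin 2) (Fin 2) ℂ) = rotW := rfl

/-- `γW` is an isometry of the definite form: the polynomial identity of the rotation. -/
theorem isIsom_W : IsIsom σW dW rotW := by
  intro x y
  have h3 : σW 3 = 3 := map_ofNat σW 3
  have h4 : σW 4 = 4 := map_ofNat σW 4
  have h5 : σW 5 = 5 := map_ofNat σW 5
  simp only [herm, dW, Fin.sum_univ_two, one_mul, mulVec_two, rotW, Matrix.of_apply,
    Matrix.cons_val', Matrix.cons_val_zero, Matrix.cons_val_one, Matrix.empty_val',
    Matrix.cons_val_fin_one, map_add, map_mul, map_neg, map_div₀, h3, h4, h5]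
  ring

/-- the double-coset invariant of witness (W): `κ(γW) = N(3/5) / (1 · 1) = 9/25`. -/
theorem kappa_W : kappa σW dW fW rotW = 9 / 25 := by
  simp only [kappa, disc'_W, nrm, cc, dW, fW, mulVec_two, rotW, Matrix.of_apply, Matrix.cons_val',
    Matrix.cons_val_zero, Matrix.cons_val_one, Matrix.empty_val', Matrix.cons_val_fin_one,
    Pi.single_eq_same, Pi.single_eq_of_ne (show (1 : Fin 2) ≠ 0 by decide)]
  norm_num [map_ofNat]

/-- `κ(γW) ≠ 0`. -/
theorem hκ0_W : kappa σW dW fW rotW ≠ 0 := by rw [kappa_W]; norm_num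

/-- `κ(γW) ≠ 1`. -/
theorem hκ1_W : kappa σW dW fW rotW ≠ 1 := by rw [kappa_W]; norm_num

/-- **the witness for row 721's `regular_of_kappa`**: `Regular 1 γW`, every displayed hypothesis discharged. -/
theorem regular_W : Regular (1 : GL (Fin 2) ℂ) γW :=
  regular_of_kappa σW dW hd_W hd0_W fW hf0_W 1 γW hP_W isIsom_W hκ0_W hκ1_W

/-- cross-check against the definition: the column `j = 0` of `γW · 1` is `(3/5, 4/5)`, no zero entry. -/
theorem regular_W_direct : Regular (1 : GL (Fin 2) ℂ) γW := by
  refine ⟨0, ?_, ?_⟩ <;> simp [coe_γW, rotW, Units.val_one]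

/-! ## Witness (U): a unitary, non-orthogonal isometry with entries moved by `σ` -/

/-- the element `[[3i/5, −4/5], [4/5, −3i/5]]` of `SU(2)`. -/
noncomputable def rotU : Matrix (Fin 2) (Fin 2) ℂ := !![3 / 5 * I, -4 / 5; 4 / 5, -3 / 5 * I]

/-- its inverse (= its conjugate transpose). -/
noncomputable def rotUinv : Matrix (Fin 2) (Fin 2) ℂ := !![-3 / 5 * I, 4 / 5; -4 / 5, 3 / 5 * I]

/-- `rotU · rotUinv = 1`. -/
theorem rotU_mul_rotUinv : rotU * rotUinv = 1 := by
  ext i j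
  fin_cases i <;> fin_cases j <;>
    simp [rotU, rotUinv, Matrix.mul_apply, Fin.sum_univ_two] <;> ring_nf <;> simp [Complex.I_sq] <;> norm_num

/-- `rotUinv · rotU = 1`. -/
theorem rotUinv_mul_rotU : rotUinv * rotU = 1 := by
  ext i j
  fin_cases i <;> fin_cases j <;>
    simp [rotU, rotUinv, Matrix.mul_apply, Fin.sum_univ_two] <;> ring_nf <;> simp [Complex.I_sq] <;> norm_num

/-- the unitary element as an element of `GL (Fin 2) ℂ`. -/
noncomputable def γU : GL (Fin 2) ℂ := ⟨rotU, rotUinv, rotU_mul_rotUinv, rotUinv_mul_rotU⟩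

/-- the matrix of `γU`. -/
theorem coe_γU : (γU : Matrix (Fin 2) (Fin 2) ℂ) = rotU := rfl

/-- the entries of `γU` are moved by the involution: `σ (3i/5) = −3i/5 ≠ 3i/5` — `γU` is not a real point. -/
theorem rotU_moved : σW (rotU 0 0) ≠ rotU 0 0 := by
  simp only [rotU, Matrix.of_apply, Matrix.cons_val', Matrix.cons_val_zero, Matrix.empty_val',
    Matrix.cons_val_fin_one, map_mul, map_div₀, Complex.conj_I, map_ofNat σW 3, map_ofNat σW 5]
  intro h
  have : (6 / 5 : ℂ) * I = 0 := by linear_combination -h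
  simp at this

/-- `γU` is an isometry of the definite form: the polynomial identity with `i² = −1`. -/
theorem isIsom_U : IsIsom σW dW rotU := by
  intro x y
  have h3 : σW 3 = 3 := map_ofNat σW 3
  have h4 : σW 4 = 4 := map_ofNat σW 4
  have h5 : σW 5 = 5 := map_ofNat σW 5
  simp only [herm, dW, Fin.sum_univ_two, one_mul, mulVec_two, rotU, Matrix.of_apply,
    Matrix.cons_val', Matrix.cons_val_zero, Matrix.cons_val_one, Matrix.empty_val',
    Matrix.cons_val_fin_one, map_add, map_mul, map_neg, map_div₀, h3, h4, h5, Complex.conj_I]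
  linear_combination (-9 / 25 : ℂ) * (x 0 * σW (y 0) + x 1 * σW (y 1)) * Complex.I_sq

/-- the double-coset invariant of witness (U): `κ(γU) = N(3i/5) / (1 · 1) = 9/25`. -/
theorem kappa_U : kappa σW dW fW rotU = 9 / 25 := by
  simp only [kappa, disc'_W, nrm, cc, dW, fW, mulVec_two, rotU, Matrix.of_apply, Matrix.cons_val',
    Matrix.cons_val_zero, Matrix.cons_val_one, Matrix.empty_val', Matrix.cons_val_fin_one,
    Pi.single_eq_same, Pi.single_eq_of_ne (show (1 : Fin 2) ≠ 0 by decide)]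
  simp only [mul_one, mul_zero, add_zero, one_mul, div_one, map_mul, map_div₀, Complex.conj_I,
    map_ofNat σW 3, map_ofNat σW 5]
  ring_nf
  simp [Complex.I_sq]
  norm_num

/-- `κ(γU) ≠ 0`. -/
theorem hκ0_U : kappa σW dW fW rotU ≠ 0 := by rw [kappa_U]; norm_num

/-- `κ(γU) ≠ 1`. -/
theorem hκ1_U : kappa σW dW fW rotU ≠ 1 := by rw [kappa_U]; norm_num

/-- **the witness (U) for row 721's `regular_of_kappa`**: `Regular 1 γU`. -/
theorem regular_U : Regular (1 : GL (Fin 2) ℂ) γU :=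
  regular_of_kappa σW dW hd_W hd0_W fW hf0_W 1 γU hP_W isIsom_U hκ0_U hκ1_U

/-! ## The characters and (C) on the norm-one scalars -/

/-- the character `χA = det ∘ iotaA` of the first torus. -/
noncomputable def χA_W : torusA σW →* ℂˣ := Matrix.GeneralLinearGroup.det.comp (iotaA σW)

/-- the character `ψB = (det ∘ iotaB)⁻¹` of the second torus. -/
noncomputable def ψB_W : torusB σW fW →* ℂˣ := (Matrix.GeneralLinearGroup.det.comp (iotaB σW fW))⁻¹

/-- the norm-one diagonal element `diag(−1, 1)` of the first torus. -/
theorem diagNegOne_mem_torusA : (fun i : Fin 2 => if i = 0 then (-1 : ℂˣ) else 1) ∈ torusA σW := by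
  refine (Subgroup.mem_pi Set.univ).2 fun i _ => (mem_normOne σW _).2 ?_
  fin_cases i <;> simp [nrm, σW]

/-- `χA` is not the trivial character: at `diag(−1, 1)` it is `det = −1`. -/
theorem χA_W_ne_one : χA_W ≠ 1 := by
  intro h
  have := congrArg (fun φ : torusA σW →* ℂˣ => (φ ⟨_, diagNegOne_mem_torusA⟩ : ℂ)) h
  simp only [χA_W, MonoidHom.comp_apply, Matrix.GeneralLinearGroup.val_det_apply, MonoidHom.one_apply,
    Units.val_one] at this
  rw [show ((iotaA σW ⟨_, diagNegOne_mem_torusA⟩ : GL (Fin 2) ℂ) : Matrix (Fin 2) (Fin 2) ℂ) =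
      Matrix.diagonal (fun i : Fin 2 => if i = 0 then (-1 : ℂ) else 1) from by
        ext i j
        simp [iotaA, diagUnitHom, diagUnit, Matrix.diagonal_apply]
        split_ifs <;> simp_all] at this
  rw [Matrix.det_diagonal, Fin.prod_univ_two] at this
  norm_num at this

/-- the diagonal matrix `diag(−1, 1)` as an element of `GL (Fin 2) ℂ`. -/
noncomputable def eB : GL (Fin 2) ℂ := diagUnit (fun i : Fin 2 => if i = 0 then (-1 : ℂˣ) else 1)

/-- `diag(−1, 1)` lies in the second torus: it acts on the standard basis by the norm-one scalars `(−1, 1)`. -/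
theorem eB_mem : eB ∈ torusB σW fW := by
  refine (mem_torusB σW fW eB).2 ⟨fun i => if i = 0 then (-1 : ℂ) else 1, ?_, ?_⟩
  · intro i; fin_cases i <;> simp [nrm, σW]
  · intro j
    ext i
    simp only [eB, coe_diagUnit, Matrix.mulVec_diagonal, fW, Pi.smul_apply, Pi.single_apply, smul_eq_mul]
    split_ifs <;> simp_all

/-- `det diag(−1, 1) = −1`. -/
theorem det_eB : (Matrix.GeneralLinearGroup.det eB : ℂ) = -1 := by
  rw [Matrix.GeneralLinearGroup.val_det_apply, eB, coe_diagUnit, Matrix.det_diagonal, Fin.prod_univ_two]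
  simp

/-- `ψB` is not the trivial character: at `diag(−1, 1)` it is `det⁻¹ = −1`. -/
theorem ψB_W_ne_one : ψB_W ≠ 1 := by
  intro h
  have := congrArg (fun φ : torusB σW fW →* ℂˣ => (φ ⟨eB, eB_mem⟩ : ℂ)) h
  simp only [ψB_W, MonoidHom.inv_apply, MonoidHom.comp_apply, MonoidHom.one_apply, Units.val_one,
    Units.val_inv_eq_inv_val] at this
  rw [show iotaB σW fW ⟨eB, eB_mem⟩ = eB from rfl, det_eB] at this
  norm_num at this

/-- `det (iotaA (scalarA z)) = z²`: the matrix is `z • 1` (row 721's `coe_iotaA_scalarA`). -/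
theorem det_iotaA_scalarA (z : ℂ) (hz : nrm σW z = 1) :
    (Matrix.GeneralLinearGroup.det (iotaA σW (scalarA σW z hz)) : ℂ) = z ^ 2 := by
  rw [Matrix.GeneralLinearGroup.val_det_apply, coe_iotaA_scalarA, Matrix.det_smul, Matrix.det_one,
    Fintype.card_fin, mul_one]

/-- `det (iotaB (scalarB z)) = z²`: the matrix is `z • 1` (row 721's `coe_iotaB_scalarB`). -/
theorem det_iotaB_scalarB (z : ℂ) (hz : nrm σW z = 1) :
    (Matrix.GeneralLinearGroup.det (iotaB σW fW (scalarB σW fW z hz)) : ℂ) = z ^ 2 := by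
  rw [Matrix.GeneralLinearGroup.val_det_apply, coe_iotaB_scalarB, Matrix.det_smul, Matrix.det_one,
    Fintype.card_fin, mul_one]

/-- **(C) on the norm-one scalars** for the witness characters: `z² · (z²)⁻¹ = 1`
(`det_iotaA_scalarA`, `det_iotaB_scalarB`). -/
theorem hC_W : ∀ (z : ℂ) (hz : nrm σW z = 1), χA_W (scalarA σW z hz) * ψB_W (scalarB σW fW z hz) = 1 := by
  intro z hz
  have hz0 : z ≠ 0 := ne_zero_of_nrm_eq_one σW hz
  apply Units.ext
  simp only [χA_W, ψB_W, MonoidHom.inv_apply, MonoidHom.comp_apply, Units.val_mul, Units.val_inv_eq_inv_val,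
    Units.val_one]
  rw [det_iotaA_scalarA, det_iotaB_scalarB, mul_inv_cancel₀ (pow_ne_zero 2 hz0)]

/-- **the witness (W) for row 721's consumer `hmatch_of_central`**: x1's `hmatch` binder holds for the datum
`(σ, d, f, P = 1, loc γ₀ = γW, χA, ψB)` — every displayed hypothesis discharged above. -/
theorem hmatch_W :
    ∀ a b, (iotaA σW a)⁻¹ * γW * iotaB σW fW b = γW → χA_W a * ψB_W b = 1 :=
  hmatch_of_central σW fW hP_W (fun _ : Unit => γW) () regular_W χA_W ψB_W hC_W

/-- **the witness (U) for `hmatch_of_central`**: the same with the unitary, non-orthogonal `γU`. -/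
theorem hmatch_U :
    ∀ a b, (iotaA σW a)⁻¹ * γU * iotaB σW fW b = γU → χA_W a * ψB_W b = 1 :=
  hmatch_of_central σW fW hP_W (fun _ : Unit => γU) () regular_U χA_W ψB_W hC_W

/-! ## The two embeddings of row 723 -/

/-- **the witness (W) for row 723's `regular_GL_map_of_map_kappa`** with `ψ₁ = ψ₂ = σ` (conjugation at both
embeddings): `Regular (map σ 1) (map σ γW)`. -/
theorem regular_map_W :
    Regular (GeneralLinearGroup.map σW (1 : GL (Fin 2) ℂ)) (GeneralLinearGroup.map σW γW) :=
  regular_GL_map_of_map_kappa σW σW σW dW hd_W hd0_W fW hf0_W hP_W isIsom_W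
    (by rw [coe_γW, kappa_W, map_div₀, map_ofNat, map_ofNat]; norm_num)
    (by rw [coe_γW, kappa_W, map_div₀, map_ofNat, map_ofNat]; norm_num)

/-- the same with `ψ₁ = σ` (the invariant read at the conjugate embedding) and `ψ₂ = id`. -/
theorem regular_map_W' :
    Regular (GeneralLinearGroup.map (RingHom.id ℂ) (1 : GL (Fin 2) ℂ)) (GeneralLinearGroup.map (RingHom.id ℂ) γW) :=
  regular_GL_map_of_map_kappa σW (RingHom.id ℂ) σW dW hd_W hd0_W fW hf0_W hP_W isIsom_W
    (by rw [coe_γW, kappa_W, map_div₀, map_ofNat, map_ofNat]; norm_num)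
    (by rw [coe_γW, kappa_W, map_div₀, map_ofNat, map_ofNat]; norm_num)

/-- **the witness (U) for row 723** with `ψ₁ = ψ₂ = σ`: `Regular (map σ 1) (map σ γU)` — here `map σ γU ≠ γU`
(`rotU_moved`), so the regularity is read at an embedding that moves the matrix. -/
theorem regular_map_U :
    Regular (GeneralLinearGroup.map σW (1 : GL (Fin 2) ℂ)) (GeneralLinearGroup.map σW γU) :=
  regular_GL_map_of_map_kappa σW σW σW dW hd_W hd0_W fW hf0_W hP_W isIsom_U
    (by rw [coe_γU, kappa_U, map_div₀, map_ofNat, map_ofNat]; norm_num)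
    (by rw [coe_γU, kappa_U, map_div₀, map_ofNat, map_ofNat]; norm_num)

end Summit.Ventures.HodgeRepro2.T7SupportRegularWitness
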